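import Literature.NumberTheory.Automorphic.ShimuraCurveRibetTakahashiPairwiseDenominatorProofs
import Literature.NumberTheory.Automorphic.ShimuraCurveRibetTakahashiComponentOrders
import HarnessLib

/-!
# Pasten 2024, Thm. 6.1 (numerator) and Thm. 6.1 (b) over the component-orders fact

Topic `NumberTheory/Automorphic`; a proofs-only companion (theorems only: no definition, no named
fact, nothing restated; D-0026) of `ShimuraCurveRibetTakahashiComponentOrders.lean`. That file types
Pasten's §6 inputs on the Néron component groups as ONE named fact
`PastenShimura2024_componentOrders` (`∃ cI cJ > 0` with Prop. 6.13, `i_p j_p = c_p(A_{D,M})`, the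
Eisenstein property of the image, and the Papikian–Rabinoff bound on the cokernel). Here that fact is
plugged into the tree's assembled proofs of Thm. 6.1:

* `PastenShimura2024_thm_6_1_of_componentOrders`: the numerator statement
  `PastenShimura2024_thm_6_1` (`ShimuraCurveRibetTakahashi.lean`) from
  `PastenShimura2024_componentOrders`, Mazur–Kenku (`mazurKenku_exists_cyclic_isogeny`, for the
  printed "`≤ 163`" of Lemma 6.8) and the Jacquet–Langlands existence fact
  `nonempty_shimuraParametrizationData` — via `PastenShimura2024_thm_6_1_of_prop_6_13_of_mazurKenku'`
  (`ShimuraCurveRibetTakahashiPairwiseDenominatorProofs`), whose hypothesis `h613` is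
  `ComponentOrders.Prop613.exists_form`.
* `PastenShimura2024_thm_6_1_b_of_componentOrders`: Thm. 6.1 (b) `PastenShimura2024_thm_6_1_b` from
  the same three facts and the remaining printed inputs of §6.5–6.8 kept as hypotheses exactly as in
  `PastenShimura2024_thm_6_1_b_of_ribetTakahashi_eisenstein_mazurKenku'`: Lemma 6.7 (`h67`,
  Chebotarev with Mazur/Faltings) and the Diophantine Lemmas 6.10–6.12 (`h610`–`h612`); the
  component-group hypotheses `cI cJ hI hJ h613 hJc hEis` of that theorem are ALL supplied by
  `PastenShimura2024_componentOrders` (`ComponentOrders.Prop613`, `.ProductEq.cokernel_dvd`,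
  `.ImageEisenstein`).

So, over the tree, Thm. 6.1 (numerator) is CLOSED MODULO the three named facts
{`PastenShimura2024_componentOrders`, `mazurKenku_exists_cyclic_isogeny`,
`nonempty_shimuraParametrizationData`}, and Thm. 6.1 (b) modulo those and Lemmas 6.7, 6.10–6.12.

## References

* [PastenShimura2024] H. Pasten, *Shimura curves and the abc conjecture*, J. Number Theory 254
  (2024) 214–335 = arXiv:1705.09251: Thm. 6.1 p. 20, §6.4 and Lemma 6.8 p. 22, §6.6, Prop. 6.13,
  Lemma 6.14 p. 23, Lemmas 6.15–6.18 p. 24, §6.9 p. 25. READ.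
* [RibetTakahashi1997] K. A. Ribet, S. Takahashi, PNAS 94 (1997) 11110–11114, Thm. 2.
* [Mazur1978] Thm. 1; [Kenku1982].
-/

noncomputable section

open scoped MatrixGroups ModularForm

namespace Literature.NumberTheory.Automorphic

open Literature.NumberTheory.EllipticCurves (mazurKenku_exists_cyclic_isogeny)

/-- **Pasten 2024, Thm. 6.1 (numerator of `γ_{D,M,E}`) from the component-orders fact, Mazur–Kenku
and Jacquet–Langlands.** The printed proof (§6.9 p. 25: (EqSequentially) from Prop. 6.13 and
Lemma 6.8, then the telescoping) as assembled in the tree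
(`PastenShimura2024_thm_6_1_of_prop_6_13_of_mazurKenku'`), with its Prop. 6.13 hypothesis `h613`
supplied by `PastenShimura2024_componentOrders` (`ComponentOrders.Prop613.exists_form`).
[cite: PastenShimura2024, Thm. 6.1 (p. 20) with §6.9 (p. 25), Prop. 6.13 (p. 23), Lemma 6.8 (p. 22)]
[cite: RibetTakahashi1997, Thm. 2] -/
theorem PastenShimura2024_thm_6_1_of_componentOrders (h : PastenShimura2024_componentOrders)
    (hMK : mazurKenku_exists_cyclic_isogeny) (hP : nonempty_shimuraParametrizationData) :
    PastenShimura2024_thm_6_1 := by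
  obtain ⟨cI, cJ, hpos, -, h613, -, -⟩ := h
  exact PastenShimura2024_thm_6_1_of_prop_6_13_of_mazurKenku' hMK hP
    (fun hp hr hpr hD hadm X₁ X₂ W _ _ hWN W₁' _ P₁ hP₁ W₂' _ P₂ hP₂ =>
      ComponentOrders.Prop613.exists_form h613 hpos hp hr hpr hD hadm X₁ X₂ W hWN W₁' P₁ hP₁ W₂'
        P₂ hP₂)

/-- **Pasten 2024, Thm. 6.1 (b) from the component-orders fact, Mazur–Kenku, Jacquet–Langlands,
Lemma 6.7 and Lemmas 6.10–6.12.** The tree's assembled proof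
`PastenShimura2024_thm_6_1_b_of_ribetTakahashi_eisenstein_mazurKenku'` (§6.5–6.9 performed in
`ShimuraCurveRibetTakahashiCokernelProofs` / `…PairwiseDenominatorProofs`) with ALL its component-group
hypotheses — the Skolem functions `cI cJ`, their positivity, Prop. 6.13 (`h613`), `j_p ∣ #Φ_p`
(`hJc`, proof of Lemma 6.15) and Ribet's Eisenstein property of the image (`hEis`, proof of
Lemma 6.14) — supplied by the one named fact `PastenShimura2024_componentOrders`; what remains as
hypotheses is Lemma 6.7 (`h67`) and the Diophantine Lemmas 6.10, 6.11, 6.12 (`h610`–`h612`), each in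
the shape of that theorem.
[cite: PastenShimura2024, Thm. 6.1 (b) (p. 20), §6.5–6.9 (pp. 22–25): Lemmas 6.7, 6.10–6.12, 6.14, 6.15, 6.18, Prop. 6.13]
[cite: RibetTakahashi1997, Thm. 2] -/
theorem PastenShimura2024_thm_6_1_b_of_componentOrders (h : PastenShimura2024_componentOrders)
    (hMK : mazurKenku_exists_cyclic_isogeny) (hP : nonempty_shimuraParametrizationData)
    {S : Finset ℕ} (h2S : 2 ∈ S)
    (h67 : ∀ ℓ : ℕ, ℓ.Prime → ∃ β : ℕ, (163 < ℓ → β = 1) ∧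
      ∀ (A : WeierstrassCurve ℚ) [A.IsElliptic],
        (∀ q : ℕ, q.Prime → q ∉ S → ¬ q ^ 2 ∣ A.conductorNorm ℤ) →
        ∀ r₀ : ℕ, ∃ r : ℕ, r₀ < r ∧ r.Prime ∧ ¬ ((ℓ ^ β : ℕ) : ℤ) ∣ (r + 1 : ℤ) - A.LFunction r)
    (h610 : ∀ L : ℕ, 7 ≤ L → {Δ : ℕ | ∃ (W : WeierstrassCurve ℚ) (_ : W.IsElliptic),
        (∀ q : ℕ, q.Prime → q ∉ S → ¬ q ^ 2 ∣ W.conductorNorm ℤ) ∧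
        W.minimalDiscriminantNorm ℤ = Δ ∧
        ∃ n k : ℕ, (∀ q : ℕ, q.Prime → q ∣ n → q ∈ S) ∧ Δ = n * k ^ L}.Finite)
    (h611 : ∀ ℓ : ℕ, ℓ.Prime → 11 ≤ ℓ → ∀ (W : WeierstrassCurve ℚ) [W.IsElliptic],
      W.IsSemistable ℤ → ∀ k : ℕ, 2 ≤ k → W.minimalDiscriminantNorm ℤ ≠ k ^ ℓ)
    (h612 : ∀ (W : WeierstrassCurve ℚ) [W.IsElliptic], IsFreyHellegouarch W →
      (∃ q : ℕ, q.Prime ∧ q ≠ 2 ∧ q ∣ W.conductorNorm ℤ) →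
      ∀ ℓ : ℕ, ℓ.Prime → 3 ≤ ℓ → ∀ k : ℕ, ordCompl[2] (W.minimalDiscriminantNorm ℤ) ≠ k ^ ℓ) :
    PastenShimura2024_thm_6_1_b := by
  obtain ⟨cI, cJ, hpos, hprod, h613, hEis, -⟩ := h
  exact PastenShimura2024_thm_6_1_b_of_ribetTakahashi_eisenstein_mazurKenku' hMK hP
    (fun P p => cI P p) (fun P p => cJ P p) (fun P p => (hpos P p).1) (fun P p => (hpos P p).2)
    h613 (ComponentOrders.ProductEq.cokernel_dvd hprod) h2S hEis h67 h610 h611 h612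

end Literature.NumberTheory.Automorphic

end
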